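import Mathlib.Analysis.SpecialFunctions.Pow.Real
import Mathlib.Analysis.SpecialFunctions.Sqrt
import Literature.Probability.LatticeModels.ScalingLimit
import Literature.Probability.LatticeModels.IsingThermodynamics
import Literature.Probability.LatticeModels.PointwiseScalingLimitScale
import HarnessLib

/-!
# Crux `LogPolarProxy.ProxyUniversality` (stmt-CriticalPhenomena-11288), line `birth` — stub S2

`stub_scalingLimitRigidity` — **rigidity of the renormalisation gauge of a pointwise scaling limit
of the critical `ℤ³` correlators.** Two non-degenerate pointwise scaling limits `(ρ, S)` and
`(ρ', S')` (`ρ, ρ' > 0` on `(0, 1]`) of the SAME lattice family `criticalCorr 3` differ by a single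
positive scale: `ρ δ / ρ' δ → c ∈ (0, ∞)` as `δ → 0⁺` and `S n x = cⁿ · S' n x` for every `n` and
every non-coincident configuration `x`.

Proof (elementary real analysis, the device of
`Literature.Probability.LatticeModels.HasPointwiseScalingLimit.exists_scale`, here with the ratio
limit exported): at the reference pair `x₀ = (0, e₀) ∈ NonCoincident 3 2` the same lattice two-point
value `g δ` sits in `ρ δ ^ 2 * g δ → S 2 x₀ > 0` and `ρ' δ ^ 2 * g δ → S' 2 x₀ > 0`, hence
`(ρ/ρ')² → S 2 x₀ / S' 2 x₀ > 0`; positivity of `ρ/ρ'` on `(0,1] ∈ 𝓝[>] 0` and continuity of `√·`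
give `ρ/ρ' → c := (S 2 x₀ / S' 2 x₀)^{1/2} > 0`; finally `ρⁿ Gₙ = (ρ/ρ')ⁿ · ρ'ⁿ Gₙ` eventually, both
sides converge, and limits along the non-trivial filter `𝓝[>] 0` are unique.

The general-`d` form `exists_scale_tendsto` (any lattice family, positivity at one common pair) is
proved first; the stub is its instance `d = 3`, `G = criticalCorr 3`, `x₀ = (0, e₀)`.
No definitions, no named facts; axioms standard.

References: shape of D. Chelkak, C. Hongler, K. Izyurov, Ann. Math. 181 (2015), Thm 1.1
(normalisation `ρ(δ) = δ^{-1/8}`); folklore.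
-/

namespace Summit.CriticalPhenomena.Ising3DConformalLimit.Cruxes.ProxyUniversality.Birth

open Filter Set Function Topology
open scoped Topology
open Literature.Probability.LatticeModels

/-- A pair of distinct points of `ℝ^d` is a non-coincident `2`-configuration. [folklore] -/
theorem pair_mem_nonCoincident {d : ℕ} {p q : EuclideanSpace ℝ (Fin d)} (h : p ≠ q) :
    (![p, q] : Fin 2 → EuclideanSpace ℝ (Fin d)) ∈ NonCoincident d 2 := by
  -- adapted from Literature/Probability/LatticeModels/PointwiseScalingLimitScale.lean
  -- (pair_mem_nonCoincident_aux)
  rw [mem_nonCoincident]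
  intro i j hij
  fin_cases i <;> fin_cases j
  · rfl
  · exact absurd hij h
  · exact absurd hij.symm h
  · rfl

/-- **Uniqueness of a pointwise scaling limit up to one scale, with the scale as a limit of the
renormalisation ratio.** If `S` (renormalisation `ρ > 0` on `(0,1]`) and `S'` (renormalisation
`ρ' > 0` on `(0,1]`) are pointwise scaling limits of the same lattice family `G`, with two-point
functions positive at one common non-coincident pair `x₀`, then for
`c := (S 2 x₀ / S' 2 x₀)^{1/2} > 0` one has `ρ δ / ρ' δ → c` as `δ → 0⁺` and
`S n x = c ^ n * S' n x` for every `n` and every non-coincident `x`. [folklore] -/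
theorem exists_scale_tendsto {d : ℕ} {G : LatticeCorrFamily d} {ρ ρ' : ℝ → ℝ}
    {S S' : CorrFamily d} (hρ : ∀ δ ∈ Set.Ioc (0:ℝ) 1, 0 < ρ δ)
    (hρ' : ∀ δ ∈ Set.Ioc (0:ℝ) 1, 0 < ρ' δ)
    (hlim : HasPointwiseScalingLimit G ρ S) (hlim' : HasPointwiseScalingLimit G ρ' S')
    {x₀ : Fin 2 → EuclideanSpace ℝ (Fin d)} (hx₀ : x₀ ∈ NonCoincident d 2) (ha0 : 0 < S 2 x₀)
    (hb0 : 0 < S' 2 x₀) :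
    ∃ c : ℝ, 0 < c ∧ Tendsto (fun δ : ℝ => ρ δ / ρ' δ) (𝓝[>] (0:ℝ)) (𝓝 c) ∧
      ∀ n, ∀ x ∈ NonCoincident d n, S n x = c ^ n * S' n x := by
  -- adapted from Literature/Probability/LatticeModels/PointwiseScalingLimitScale.lean
  -- (exists_scale): roles of `(ρ, S)` and `(ρ', S')` swapped, the ratio limit `hr` exported.
  set g : ℝ → ℝ := fun δ => G 2 (fun i => latticeApprox δ (x₀ i)) with hg
  have ha : Tendsto (fun δ => ρ δ ^ 2 * g δ) (𝓝[>] 0) (𝓝 (S 2 x₀)) := (hlim 2).tendsto_at hx₀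
  have hb : Tendsto (fun δ => ρ' δ ^ 2 * g δ) (𝓝[>] 0) (𝓝 (S' 2 x₀)) := (hlim' 2).tendsto_at hx₀
  have hIoc : Set.Ioc (0:ℝ) 1 ∈ 𝓝[>] (0:ℝ) := Ioc_mem_nhdsGT one_pos
  have hev : ∀ᶠ δ in 𝓝[>] (0:ℝ), δ ∈ Set.Ioc (0:ℝ) 1 ∧ 0 < ρ' δ ^ 2 * g δ :=
    (Filter.eventually_of_mem hIoc fun δ hδ => hδ).and (hb.eventually_const_lt hb0)
  have hr2 : Tendsto (fun δ => (ρ δ / ρ' δ) ^ 2) (𝓝[>] 0) (𝓝 (S 2 x₀ / S' 2 x₀)) := by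
    have hq : Tendsto (fun δ => (ρ δ ^ 2 * g δ) / (ρ' δ ^ 2 * g δ)) (𝓝[>] 0)
        (𝓝 (S 2 x₀ / S' 2 x₀)) := ha.div hb hb0.ne'
    refine hq.congr' ?_
    filter_upwards [hev] with δ hδ
    have hg0 : g δ ≠ 0 := by
      intro h0; rw [h0, mul_zero] at hδ; exact lt_irrefl _ hδ.2
    rw [div_pow, mul_div_mul_right _ _ hg0]
  set c : ℝ := Real.sqrt (S 2 x₀ / S' 2 x₀) with hc
  have hcpos : 0 < c := Real.sqrt_pos.2 (div_pos ha0 hb0)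
  have hr : Tendsto (fun δ => ρ δ / ρ' δ) (𝓝[>] 0) (𝓝 c) := by
    refine hr2.sqrt.congr' ?_
    filter_upwards [hev] with δ hδ
    exact Real.sqrt_sq (div_pos (hρ δ hδ.1) (hρ' δ hδ.1)).le
  refine ⟨c, hcpos, hr, fun n x hx => ?_⟩
  have h1 : Tendsto (fun δ => ρ δ ^ n * G n (fun i => latticeApprox δ (x i)))
      (𝓝[>] 0) (𝓝 (S n x)) := (hlim n).tendsto_at hx
  have h2 : Tendsto (fun δ => (ρ δ / ρ' δ) ^ n * (ρ' δ ^ n * G n (fun i => latticeApprox δ (x i))))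
      (𝓝[>] 0) (𝓝 (c ^ n * S' n x)) := (hr.pow n).mul ((hlim' n).tendsto_at hx)
  refine tendsto_nhds_unique h1 (h2.congr' ?_)
  filter_upwards [hev] with δ hδ
  have hρ0 : ρ' δ ≠ 0 := (hρ' δ hδ.1).ne'
  rw [div_pow, ← mul_assoc, div_mul_cancel₀ _ (pow_ne_zero n hρ0)]

/-- **S2 `stub_scalingLimitRigidity` — a pointwise scaling limit of `criticalCorr 3` is unique up to
the normalisation of the spin.** Two non-degenerate limit pairs `(ρ, S)`, `(ρ', S')` of the critical
`ℤ³` correlators, with renormalisations positive on `(0, 1]`, satisfy `ρ δ / ρ' δ → c ∈ (0, ∞)` as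
`δ → 0⁺` and `S n x = c ^ n * S' n x` on `NonCoincident 3 n` for every `n`. Instance `d = 3`,
`G = criticalCorr 3` of `exists_scale_tendsto` at the reference pair `x₀ = (0, e₀)`.
[folklore; shape of ChelkakHonglerIzyurov2015 Thm 1.1] -/
theorem stub_scalingLimitRigidity :
    ∀ (ρ ρ' : ℝ → ℝ) (S S' : CorrFamily 3), (∀ δ ∈ Set.Ioc (0:ℝ) 1, 0 < ρ δ) →
      (∀ δ ∈ Set.Ioc (0:ℝ) 1, 0 < ρ' δ) →
      HasPointwiseScalingLimit (criticalCorr 3) ρ S →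
      HasPointwiseScalingLimit (criticalCorr 3) ρ' S' →
      IsNondegenerateTwoPoint S → IsNondegenerateTwoPoint S' →
      ∃ c : ℝ, 0 < c ∧ Tendsto (fun δ : ℝ => ρ δ / ρ' δ) (𝓝[>] (0:ℝ)) (𝓝 c) ∧
        ∀ (n : ℕ), ∀ x ∈ NonCoincident 3 n, S n x = c ^ n * S' n x := by
  intro ρ ρ' S S' hρ hρ' hlim hlim' hnd hnd'
  have hx₀ : (![0, EuclideanSpace.single (0 : Fin 3) (1:ℝ)] : Fin 2 → EuclideanSpace ℝ (Fin 3))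
      ∈ NonCoincident 3 2 := by
    refine pair_mem_nonCoincident fun h => ?_
    have := congrArg (fun v : EuclideanSpace ℝ (Fin 3) => v 0) h
    simp at this
  exact exists_scale_tendsto hρ hρ' hlim hlim' hx₀ (hnd _ hx₀) (hnd' _ hx₀)

end Summit.CriticalPhenomena.Ising3DConformalLimit.Cruxes.ProxyUniversality.Birth
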